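import Literature.NumberTheory.Transcendental.FischlerRivoalCorollary1OfAndre
import Literature.RingTheory.PowerSeries.LaurentLinearODESolutions
import HarnessLib

/-!
# Fischler–Rivoal's Corollary 1 from Conjecture 2 and André's theorem in the shape "a basis of holomorphic solutions at `z = 1`"

`Literature/NumberTheory/Transcendental/FischlerRivoalCorollary1OfAndreBasis.lean` — PROVED, no
definition. Fifth proofs file of the named fact `FischlerRivoal2024_corollary1`. It upgrades the
explicit hypothesis of `FischlerRivoalCorollary1OfAndre.lean` ("every formal Laurent solution at
`z = 1` is a power series") to the shape in which André's theorem is printed and used by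
Fischler–Rivoal [FischlerRivoal2024, §5.1, Proposition 4: "all solutions of `Ly = 0` are
holomorphic … at `ξ`"]: the annihilating operator `Λ` of order `m` has `m` linearly independent
power-series solutions at `z = 1`. The bridge is the Wronskian bound over the differential field
`ℂ((z−1))` (`LaurentLinearODESolutions.lean`): `dim_ℂ Sol ≤ m`, so a power-series basis leaves no
room for a solution with a pole.

* `FischlerRivoal2024_corollary1_of_andreBasis (H) : FischlerRivoal2024_corollary1` — with
  `H` = « for every strict `E`-sequence `b`, some `Λ = ∑_{k≤m} Λₖ∂ᵏ` (`Λₖ ∈ ℂ[z]`, `Λₘ ≠ 0`)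
  annihilates `∑ n! bₙ zⁿ` in `ℂ⟦z⟧` and has `m` `ℂ`-linearly independent solutions in `ℂ⟦z−1⟧` ».
  `H` is the Э-form of [Andre2000GevreyI] (not in the tree) and stays explicit; discharging it
  discharges the fact.

## References

* [FischlerRivoal2024] S. Fischler, T. Rivoal, J. Number Theory 261 (2024), §5.1.
* [Andre2000GevreyI] Y. André, Ann. of Math. 151 (2000), 705–740.
-/

noncomputable section

open Finset Complex
open scoped Nat

namespace Literature.NumberTheory.Transcendental


open Literature.Barriers.Schanuel Literature.RingTheory.PowerSeries Polynomial FischlerRivoalCor1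

/-- **Fischler–Rivoal's Corollary 1 from Conjecture 2 and André's theorem in its printed shape
("a basis of holomorphic solutions at `z = 1`").** Hypothesis `H`: every Э-function
`𝔤 = ∑ n!·bₙzⁿ` is annihilated by a linear differential operator `Λ = ∑_{k≤m} Λₖ(z)∂ᵏ` with
polynomial coefficients and `Λₘ ≠ 0` which admits, at `z = 1`, `m` formal power-series solutions
linearly independent over `ℂ` (André: an `E`-operator kills `𝔤(1/x)` and has no non-trivial
singularity outside `{0, ∞}` [Andre2000GevreyI]; the formal version is weaker than holomorphy).
By the Wronskian bound over `ℂ((z−1))` (`exists_powerSeries_of_laurentOp_eq_zero`,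
`LaurentLinearODESolutions.lean`) such a basis excludes Laurent solutions with poles, which is the
hypothesis of `FischlerRivoal2024_corollary1_of_andreRegularity`. `H` is explicit and NOT
discharged here. PROVED (the deduction). [cite: FischlerRivoal2024, Corollary 1 (§1, p. 4) and §5.1] -/
theorem FischlerRivoal2024_corollary1_of_andreBasis
    (H : ∀ (b : ℕ → ℂ), IsStrictEFunction b →
      ∃ (m : ℕ) (Λ : ℕ → Polynomial ℂ), Λ m ≠ 0 ∧
        (∑ k ∈ Finset.range (m + 1),
          (Λ k : PowerSeries ℂ) * (⇑(PowerSeries.derivative ℂ))^[k] (antiESeries b) = 0) ∧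
        ∃ y : Fin m → PowerSeries ℂ, LinearIndependent ℂ y ∧
          ∀ i, (∑ k ∈ Finset.range (m + 1),
            ((((Λ k).comp (Polynomial.X + Polynomial.C 1) : Polynomial ℂ) : PowerSeries ℂ) :
              LaurentSeries ℂ) * (⇑(LaurentSeries.derivative ℂ))^[k] (y i : LaurentSeries ℂ)) = 0) :
    FischlerRivoal2024_corollary1 := by
  refine FischlerRivoal2024_corollary1_of_andreRegularity fun b hb => ?_
  obtain ⟨m, Λ, hΛm, hann, y, hy, hsol⟩ := H b hb
  refine ⟨m, Λ, hΛm, hann, fun w hw => ?_⟩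
  set q : ℕ → LaurentSeries ℂ := fun k =>
    ((((Λ k).comp (Polynomial.X + Polynomial.C 1) : Polynomial ℂ) : PowerSeries ℂ) :
      LaurentSeries ℂ) with hq
  have hqm : q m ≠ 0 := by
    rw [hq]
    show iota1 (Λ m) ≠ 0
    exact (map_ne_zero_iff _ iota1_injective).2 hΛm
  exact exists_powerSeries_of_laurentOp_eq_zero q hqm y (fun i => by rw [laurentOp_apply]; exact hsol i)
    hy (by rw [laurentOp_apply]; exact hw)

open MeasureTheory Set Real in
/-- **What the two published inputs give the Schanuel route.** Under Fischler–Rivoal's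
Conjecture 2 (verbatim, as in the fact's antecedent) and André's theorem in the shape `H` of
`FischlerRivoal2024_corollary1_of_andreBasis`, the number `J = ∫₀^∞ e^{−x}/√(1+x) dx` of
`Summit.Schanuel.Schanuel.Theses.GaussianStokesSector.AntiEValueTranscendental` is transcendental
(instance `α = 1`, `s = −1/2` of Corollary 1). Both hypotheses stay explicit. PROVED (the deduction).
[cite: FischlerRivoal2024, Corollary 1 (§1, p. 4)] -/
theorem transcendental_integral_exp_neg_div_sqrt_of_conj2_of_andreBasis
    (hC2 : ∀ (a : ℕ → ℂ), IsStrictEFunction a →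
      ∀ θ : ℝ, θ ∈ Ioo (-(Real.pi / 2)) (Real.pi / 2) → IsAntiESum a θ 1 0 →
        ∃ g : PowerSeries ℂ, IsAntiEFunction g ∧ (PowerSeries.X - 1) * g = antiESeries a)
    (H : ∀ (b : ℕ → ℂ), IsStrictEFunction b →
      ∃ (m : ℕ) (Λ : ℕ → Polynomial ℂ), Λ m ≠ 0 ∧
        (∑ k ∈ Finset.range (m + 1),
          (Λ k : PowerSeries ℂ) * (⇑(PowerSeries.derivative ℂ))^[k] (antiESeries b) = 0) ∧
        ∃ y : Fin m → PowerSeries ℂ, LinearIndependent ℂ y ∧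
          ∀ i, (∑ k ∈ Finset.range (m + 1),
            ((((Λ k).comp (Polynomial.X + Polynomial.C 1) : Polynomial ℂ) : PowerSeries ℂ) :
              LaurentSeries ℂ) * (⇑(LaurentSeries.derivative ℂ))^[k] (y i : LaurentSeries ℂ)) = 0) :
    Transcendental ℚ (∫ x in Ioi (0 : ℝ), Real.exp (-x) / Real.sqrt (1 + x)) :=
  (FischlerRivoal2024_corollary1_of_andreBasis H).transcendental_integral_exp_neg_div_sqrt hC2

open MeasureTheory Set Real in
/-- Likewise, under the same two explicit hypotheses, **Gompertz's constant
`δ = ∫₀^∞ e^{−x}/(1+x) dx` is transcendental** (instance `α = 1`, `s = −1`). PROVED (the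
deduction). [cite: FischlerRivoal2024, Corollary 1 (§1, p. 4)] -/
theorem transcendental_gompertz_of_conj2_of_andreBasis
    (hC2 : ∀ (a : ℕ → ℂ), IsStrictEFunction a →
      ∀ θ : ℝ, θ ∈ Ioo (-(Real.pi / 2)) (Real.pi / 2) → IsAntiESum a θ 1 0 →
        ∃ g : PowerSeries ℂ, IsAntiEFunction g ∧ (PowerSeries.X - 1) * g = antiESeries a)
    (H : ∀ (b : ℕ → ℂ), IsStrictEFunction b →
      ∃ (m : ℕ) (Λ : ℕ → Polynomial ℂ), Λ m ≠ 0 ∧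
        (∑ k ∈ Finset.range (m + 1),
          (Λ k : PowerSeries ℂ) * (⇑(PowerSeries.derivative ℂ))^[k] (antiESeries b) = 0) ∧
        ∃ y : Fin m → PowerSeries ℂ, LinearIndependent ℂ y ∧
          ∀ i, (∑ k ∈ Finset.range (m + 1),
            ((((Λ k).comp (Polynomial.X + Polynomial.C 1) : Polynomial ℂ) : PowerSeries ℂ) :
              LaurentSeries ℂ) * (⇑(LaurentSeries.derivative ℂ))^[k] (y i : LaurentSeries ℂ)) = 0) :
    Transcendental ℚ (∫ x in Ioi (0 : ℝ), Real.exp (-x) / (1 + x)) :=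
  (FischlerRivoal2024_corollary1_of_andreBasis H).transcendental_gompertz hC2

end Literature.NumberTheory.Transcendental

end
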